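import Literature.MathematicalPhysics.QuantumFieldTheory.Balaban1983to89.T4ReTrLipUnitary
import Summits.QuantumFields.BalabanUV.T4Continuum.Spine.NE7.QLaBudget

/-!
# Spine/NE7/QLaCriticality — the one booked IDEA-risk sub-claim of (QL-a)∣_{U=1} is MOOT at the flat configuration:
# a gauge-invariant loop variable is at its MAXIMUM there, so its dressing defect is GLOBALLY SECOND ORDER in the
# pulled-back deviation — the non-abelian `1 − cos x ≤ x²/2`, kernel-checked in the tree's unitary model

Cell `pub-balaban-gaps` (YM blitz Y1, track G2, seat `ne7`, generation 3); text of record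
`run/shared/lean/pub/pub-balaban-gaps/ne/NE7.md` v3 §4quater and census rows R28–R30.  Fifth `Spine/NE7/` file (after `Targets`
p339119, `QLa` p339533, `QLaBudget` p340302, `QLaFromNE1p` p340630).

WHY.  NE7.md v2.5 (§4ter, §7bis) concentrated NE7's entire IDEA-risk in ONE checkable sub-claim of the shared item (QL-a)∣_{U=1}
(NODE S): that the `t`-derivative of the large-field quotients' normalisation constants — `E_num[F̃] − E_den[F̃]` with
`F̃ = W_C ∘ avgⁿ` read on a bounded component's variables at the trivial exterior field — is SECOND order in the pulled-back
deviation for ALL field sizes, not only to leading order ((r1)/(r5): «in the ABELIAN model the global inequality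
`1 − cos x ≤ x²/2` makes the t-linear constant second order in `w` for ALL field sizes … the non-abelian large-fluctuation case is
the sharpest form of the shared item's sub-claim»), the conditional-mean (first-order) suppression `T4FirstOrderSize.
CondMeanSuppression` being the located mechanism of row NE1′.  THIS FILE records that AT `U = 1` no property of the two quotient
LAWS is needed at all: the loop variable of the flat configuration is the MAXIMUM of `Re tr/N` (`GaugeGroup.reTr_le_one`), so
its defect `1 − W_C(avgⁿ V)` is a non-negative function of the component's configuration `V` which vanishes to SECOND order at
`V = 1` GLOBALLY — the non-abelian analogue of `1 − cos x ≤ x²/2` is the matrix identity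
`1 − Re tr U/N = (1/2N)·‖U − 1‖²_{HS} ≤ ½‖U − 1‖²_{op}` on `U(N)` (§2, PROVED), combined with the tree's first-order tower
bookkeeping of node O3c (`T4AvgDerivBound.descend`: the `n`-fold average of `V` is, modulo gauge, within total variation
`θⁿ·tv(1, V)` of the flat configuration — consumed BY NAME from the one-step hypothesis `AvgStepContraction`, NE1a-STEP).  Hence
(§3) `0 ≤ 1 − W_C(avgⁿ V) ≤ Cc·(|C|·tv(1,V)·θⁿ)²` on the small-field domain, for every `V`, with NO expansion in the fluctuation;
(§4) the `t`-discrepancy of the logarithm of ANY quotient of two rider-tilted fibre laws supported in such configurations is at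
most `2·|t|·sup(1 − W̃)` (log-MGF sandwich, no symmetry of the laws used), i.e. the per-component shape `Spine.NE7.QLaPt` holds in
the SECOND-order currency `b = θ²` (§5, `qlaPt_of_defect`; with `θ = θ₁ = L⁻³` and the census `Λ = L⁴` this is `a = L⁻² < 1` by
`qla_secondOrder`, p340302).  The first-order (conditional-mean) channel and the ε-channel of NE7.md §4ter simply do not occur at
`U = 1`: `d(reTr)(1) = 0`.  They DO occur in the FIELD-DEPENDENT dressed terms (exterior holonomy `H₀ ≠ 1`, where
`Re tr(H₀·)` has a non-zero differential at `1`) — which are row NE1′'s object proper («linear parts at squared cost»,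
`T4FirstOrderSize`), compared between the two runs by the rate rows; not NODE S.

NON-VACUITY.  Every hypothesis of §3 is discharged at once (axial average, whole configuration space, `θ = 1`, `SU(n)`) in the
companion file `Spine/NE7/QLaCriticalityAxial.lean` (kept separate for the 400-line rule).

HONEST FRAMING.  §1–§3, §5 are [folklore] bookkeeping over the tree's abstract `GaugeGroup` ∕ `Averaging` vocabulary with the
located one-step estimate `AvgStepContraction` (NOT PRINTED as typed; [Balaban1985Averaging] Prop. 5 (156) p. 42 prints the
per-entry Jacobian rate `L^{1−d}`) and the new property `ReTrCrit` consumed as HYPOTHESES; §2 PROVES `ReTrCrit (U(n)) ½` and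
`ReTrCrit (SU(n)) ½` (Mathlib-elementary matrix analysis); §4 is elementary measure theory.  Nothing of Bałaban's densities, of the
(1.100) insert of [Balaban1989LargeFieldI] p. 201, or of the cell's D-terms is asserted: the identification of the R-operation's
normalisation constants at `U = 1` with logarithms of quotients of rider-tilted fibre laws (§4's `ν₁, ν₂`) is NODE O ∕ the format
(W-fmt) of route 1, displayed, not supplied.  (QL-a) NOT IN PRINT ([Balaban1989LargeFieldII] p. 356 defers observables); NE7 NOT
proved; spine 0∕9; fixed finite T⁴ — NOT ℝ⁴, NOT infinite volume, NOT a mass gap, NOT Clay.  Census effect (NE7.md v3): the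
sub-claim (r1)/(r5) is CLOSED at `U = 1` (criticality, this file); (QL-a)∣_{U=1} ⇐ NE1a-STEP (row O3c, located) + NODE O (format)
+ the (0.26)-type census — no conditional-mean input; NE7-own residue = WORK (NODE O functional half, S0) only.
-/

noncomputable section

open MeasureTheory Finset
open scoped BigOperators Matrix Matrix.Norms.L2Operator

namespace Summit.QuantumFields.BalabanUV.T4Continuum.Spine.NE7

open Literature.MathematicalPhysics.QuantumFieldTheory.Balaban1983to89
open Literature.MathematicalPhysics.QuantumFieldTheory.Balaban1983to89.T4Continuum
open Literature.MathematicalPhysics.QuantumFieldTheory.Balaban1983to89.T4AvgSensitivity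
open Literature.MathematicalPhysics.QuantumFieldTheory.Balaban1983to89.T4AvgDerivBound
open Literature.MathematicalPhysics.QuantumFieldTheory.Balaban1983to89.UnitaryModel

/-! ## §1 The criticality shape, the flat-fixing shape, and the flat configuration up the tower -/

section Shapes

variable {P : Params} {G : Type*} [GaugeGroup G]

/-- [shape] HYPOTHESIS SHAPE (property of the model of `G`, NOT of the averaging): QUANTITATIVE CRITICALITY of the loop-variable
function at the identity — `1 − reTr g ≤ Cc · (dist1 g)²`.  (`0 ≤ 1 − reTr g` is the interface axiom `GaugeGroup.reTr_le_one`: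
the flat holonomy MAXIMISES `Re tr/N`, so the differential of `reTr` vanishes at `1`; this shape is the second-order Taylor bound
made global.  For `G ⊂ U(N)` with `dist1 g = ‖g − 1‖_{op}`, `reTr = Re tr/N` it holds with `Cc = ½` — PROVED in §2.) [folklore] -/
def ReTrCrit (G : Type*) [GaugeGroup G] (Cc : ℝ) : Prop := ∀ g : G, 1 - reTr g ≤ Cc * dist1 g ^ 2

/-- [shape] HYPOTHESIS SHAPE (property of the averaging): the average of the TRIVIAL configuration is trivial, `avg 1 = 1`, at every
level in the standing range ([Balaban1985Averaging] (15) p. 19 with `U ≡ 1`: every `log U(Γ_{c,x})U(c)⁻¹ = 0`; the tree's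
abstract `Setup.Averaging` records only covariance and locality, so it is carried as a hypothesis). [folklore] -/
def AvgFlat (av : ∀ j, Averaging P j G) : Prop := ∀ j, j + 1 ≤ P.m + P.K → (av j).avg 1 = 1

/-- Under `AvgFlat`, every iterate of the trivial configuration is trivial. [folklore] -/
theorem iterFrom_one {av : ∀ j, Averaging P j G} (hflat : AvgFlat av) {k : ℕ} :
    ∀ n : ℕ, k + n ≤ P.m + P.K → iterFrom av k n (1 : GaugeField P k G) = 1
  | 0, _ => rfl
  | n + 1, hn => by
    rw [iterFrom_succ, iterFrom_one hflat n (by omega)]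
    exact hflat (k + n) (by omega)

/-- The trivial configuration has trivial parallel transports. [folklore] -/
theorem holAt_one {j : ℕ} : ∀ γ : List (LStep P j), holAt (1 : GaugeField P j G) γ = 1
  | [] => holAt_nil _
  | s :: γ => by
    rw [holAt_cons, holAt_one γ, mul_one]
    rcases s with ⟨b, _ | _⟩ <;> simp [show (1 : GaugeField P j G) b = 1 from rfl]

/-- … and loop variables equal to `1`. [folklore] -/
theorem loopAt_one {j : ℕ} (γ : List (LStep P j)) : loopAt (1 : GaugeField P j G) γ = 1 := by
  rw [loopAt, holAt_one, GaugeGroup.reTr_one]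

/-- The distance of a holonomy to the identity is its `bdist` from the flat holonomy. [folklore] -/
theorem dist1_holAt_eq_bdist {j : ℕ} (Y : GaugeField P j G) (γ : List (LStep P j)) :
    dist1 (holAt Y γ) = bdist (holAt (1 : GaugeField P j G) γ) (holAt Y γ) := by
  rw [bdist_def, holAt_one, inv_one, one_mul]

/-- LOOP DEFECTS ARE NON-NEGATIVE: the flat holonomy maximises the loop variable (interface axiom). [folklore] -/
theorem loopDefect_nonneg {j : ℕ} (U : GaugeField P j G) (γ : List (LStep P j)) : 0 ≤ 1 - loopAt U γ :=
  sub_nonneg.mpr (GaugeGroup.reTr_le_one _)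

end Shapes

/-! ## §2 The non-abelian `1 − cos x ≤ x²/2`: `ReTrCrit ½` in the unitary model (PROVED) -/

section MatrixModel

variable {n : Type*} [Fintype n] [DecidableEq n]

/-- `‖z − 1‖² = ‖z‖² − 2·Re z + 1` for a complex number. [folklore] -/
theorem norm_sub_one_sq (z : ℂ) : ‖z - 1‖ ^ 2 = ‖z‖ ^ 2 - 2 * z.re + 1 := by
  rw [Complex.sq_norm, Complex.sq_norm, Complex.normSq_apply, Complex.normSq_apply]
  simp only [Complex.sub_re, Complex.one_re, Complex.sub_im, Complex.one_im, sub_zero]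
  ring

/-- The columns of a unitary matrix are unit vectors: `Σ_k ‖U_{ki}‖² = 1`. [folklore] -/
theorem sum_norm_sq_col_eq_one {U : Matrix n n ℂ} (hU : U ∈ Matrix.unitaryGroup n ℂ) (i : n) :
    ∑ k, ‖U k i‖ ^ 2 = 1 := by
  have h : (star U * U) i i = (1 : Matrix n n ℂ) i i := by rw [Unitary.star_mul_self_of_mem hU]
  rw [Matrix.mul_apply, Matrix.one_apply_eq] at h
  have h' : (∑ k, star (U k i) * U k i) = (1 : ℂ) := by
    simpa only [Matrix.star_apply] using h
  have h'' : (∑ k, (‖U k i‖ ^ 2 : ℂ)) = (1 : ℂ) := by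
    rw [← h']
    exact Finset.sum_congr rfl fun k _ => (Complex.conj_mul' (U k i)).symm
  exact_mod_cast h''

/-- The column defect of a unitary matrix: `Σ_k ‖(U − 1)_{ki}‖² = 2·(1 − Re U_{ii})`. [folklore] -/
theorem sum_norm_sq_col_sub_one {U : Matrix n n ℂ} (hU : U ∈ Matrix.unitaryGroup n ℂ) (i : n) :
    ∑ k, ‖(U - 1) k i‖ ^ 2 = 2 * (1 - (U i i).re) := by
  have hsplit : ∑ k, ‖(U - 1) k i‖ ^ 2 = ‖(U - 1) i i‖ ^ 2 + ∑ k ∈ univ.erase i, ‖(U - 1) k i‖ ^ 2 :=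
    (Finset.add_sum_erase _ _ (mem_univ i)).symm
  have hdiag : ‖(U - 1) i i‖ ^ 2 = ‖U i i‖ ^ 2 - 2 * (U i i).re + 1 := by
    rw [Matrix.sub_apply, Matrix.one_apply_eq, norm_sub_one_sq]
  have hoff : ∑ k ∈ univ.erase i, ‖(U - 1) k i‖ ^ 2 = ∑ k ∈ univ.erase i, ‖U k i‖ ^ 2 :=
    Finset.sum_congr rfl fun k hk => by
      rw [Matrix.sub_apply, Matrix.one_apply_ne (ne_of_mem_erase hk), sub_zero]
  have hcol : ‖U i i‖ ^ 2 + ∑ k ∈ univ.erase i, ‖U k i‖ ^ 2 = 1 := by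
    rw [Finset.add_sum_erase _ (fun k => ‖U k i‖ ^ 2) (mem_univ i)]
    exact sum_norm_sq_col_eq_one hU i
  rw [hsplit, hdiag, hoff]
  linarith

/-- A column of `U − 1` is bounded by the operator norm: `Σ_k ‖(U − 1)_{ki}‖² ≤ ‖U − 1‖²_{op}` (the column is
`(U − 1)e_i`, `‖e_i‖ = 1`). [folklore] -/
theorem sum_norm_sq_col_le_opDist1_sq (U : Matrix n n ℂ) (i : n) :
    ∑ k, ‖(U - 1) k i‖ ^ 2 ≤ opDist1 U ^ 2 := by
  have h := Matrix.l2_opNorm_mulVec (U - 1) (EuclideanSpace.single i (1 : ℂ))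
  have h1 : ‖(EuclideanSpace.single i (1 : ℂ))‖ = 1 := by simp
  rw [h1, mul_one] at h
  have hv : ‖(EuclideanSpace.equiv n ℂ).symm ((U - 1) *ᵥ (EuclideanSpace.single i (1 : ℂ)))‖ ^ 2
      = ∑ k, ‖(U - 1) k i‖ ^ 2 := by
    rw [EuclideanSpace.norm_sq_eq]
    refine Finset.sum_congr rfl fun k _ => ?_
    congr 2
    simp [Matrix.col_apply]
  rw [← hv, opDist1]
  exact pow_le_pow_left₀ (norm_nonneg _) h 2

/-- **THE NON-ABELIAN `1 − cos x ≤ x²/2`.**  For a unitary matrix `U`: `1 − Re tr U/n ≤ ½·‖U − 1‖²_{op}` — the identity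
`1 − Re tr U/n = (1/2n)‖U − 1‖²_{HS}` (column by column `2(1 − Re U_{ii}) = ‖(U − 1)e_i‖²`, orthonormality of the columns)
and `‖(U − 1)e_i‖ ≤ ‖U − 1‖_{op}`.  GLOBAL on `U(n)`, no expansion. [folklore] -/
theorem one_sub_nReTr_le_half_opDist1_sq [Nonempty n] {U : Matrix n n ℂ} (hU : U ∈ Matrix.unitaryGroup n ℂ) :
    1 - nReTr U ≤ 1 / 2 * opDist1 U ^ 2 := by
  have hN : (0 : ℝ) < Fintype.card n := Nat.cast_pos.mpr Fintype.card_pos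
  have key : ∀ i : n, 1 - (U i i).re ≤ 1 / 2 * opDist1 U ^ 2 := fun i => by
    have h1 := sum_norm_sq_col_sub_one hU i
    have h2 := sum_norm_sq_col_le_opDist1_sq U i
    linarith
  have htr : nReTr U = (∑ i, (U i i).re) / Fintype.card n := by
    simp [nReTr, Matrix.trace, Complex.re_sum]
  have hsum : ∑ _i : n, (1 - 1 / 2 * opDist1 U ^ 2) ≤ ∑ i, (U i i).re :=
    Finset.sum_le_sum fun i _ => by linarith [key i]
  rw [Finset.sum_const, Finset.card_univ, nsmul_eq_mul] at hsum
  have hdiv : 1 - 1 / 2 * opDist1 U ^ 2 ≤ (∑ i, (U i i).re) / Fintype.card n := by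
    rw [le_div_iff₀ hN]
    linarith [hsum]
  rw [htr]
  linarith [hdiv]

variable [Nonempty n] {H : Type*} [Group H] (ρ : H →* Matrix n n ℂ) (hρ : ∀ h, ρ h ∈ Matrix.unitaryGroup n ℂ)

/-- **`ReTrCrit H ½` in the unitary model**: for the `GaugeGroup` structure induced by a unitary representation `ρ`
(`dist1 h = ‖ρ h − 1‖_{op}`, `reTr h = Re tr ρ(h)/n`, `UnitaryModel.GaugeGroup.ofUnitaryRep`). [folklore] -/
theorem reTrCrit_ofUnitaryRep : @ReTrCrit H (GaugeGroup.ofUnitaryRep H ρ hρ) (1 / 2) := by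
  intro g
  show 1 - nReTr (ρ g) ≤ 1 / 2 * opDist1 (ρ g) ^ 2
  exact one_sub_nReTr_le_half_opDist1_sq (hρ g)

open Literature.MathematicalPhysics.QuantumLattice in
/-- `ReTrCrit (U(n)) ½` for the tree's instance `instGaugeGroupUnitaryGroup`. [folklore] -/
theorem reTrCrit_unitaryGroup : ReTrCrit (Matrix.unitaryGroup n ℂ) (1 / 2) :=
  reTrCrit_ofUnitaryRep (unitaryFundamentalRep n ℂ) fun U => U.2

open Literature.MathematicalPhysics.QuantumLattice in
/-- `ReTrCrit (SU(n)) ½` for the tree's instance `instGaugeGroupSpecialUnitaryGroup` — the group [Balaban1987RG1] means. [folklore] -/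
theorem reTrCrit_specialUnitaryGroup : ReTrCrit (Matrix.specialUnitaryGroup n ℂ) (1 / 2) :=
  reTrCrit_ofUnitaryRep (fundamentalRep n) fundamentalRep_mem_unitaryGroup

end MatrixModel

/-! ## §3 The tower: the loop defect of an averaged configuration is SECOND order in its total variation from flat -/

section Tower

variable {P : Params} {G : Type*} [GaugeGroup G]

/-- [shape] NAME for the conclusion: the SECOND-ORDER LOOP DEFECT BOUND — for all levels `k`, all `n` with
`k + n ≤ m + K`, every closed walk `(x, w)` at level `k + n` and every domain configuration `V` of level `k` (the trivial one
being in the domain): `1 − W(avgⁿ V) ≤ Cd · (|w| · tv 1 V · θⁿ)²`.  Compare `LoopVarBound` (FIRST order in `tv`, for the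
DIFFERENCE of two loop variables): at the flat configuration the first order is absent. [folklore] -/
def LoopDefectBound (av : ∀ j, Averaging P j G) (dom : ∀ j, Set (GaugeField P j G)) (Cd θ : ℝ) : Prop :=
  ∀ (k n : ℕ), k + n ≤ P.m + P.K → ∀ (x : Site P (k + n)) (w : List (Letter P.d)), walkEnd x w = x →
    ∀ V : GaugeField P k G, V ∈ dom k → (1 : GaugeField P k G) ∈ dom k →
      1 - loopAt (iterFrom av k n V) (walk x w) ≤ Cd * ((w.length : ℝ) * tv 1 V * θ ^ n) ^ 2

/-- **THE SECOND-ORDER LOOP DEFECT FROM THE ONE-STEP CONTRACTION AND CRITICALITY** (kernel): if `reTr` is critical at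
the identity (`ReTrCrit G Cc`), the domains propagate and are gauge stable, ONE averaging step contracts total variation
modulo a coarse gauge transformation by `θ` (`AvgStepContraction`, NE1a-STEP — consumed BY NAME) and fixes the trivial
configuration (`AvgFlat`), then `LoopDefectBound av dom Cc θ`: `0 ≤ 1 − W(avgⁿ V) ≤ Cc·(|w|·tv(1,V)·θⁿ)²`.  Proof: `descend`
(tree) puts `avgⁿ V` within total variation `θⁿ·tv(1,V)` of `avgⁿ 1 = 1` modulo gauge; the holonomy along the walk is then
within `|w|·θⁿ·tv(1,V)` of the identity (`holAt_bdist_le_length_mul_tv`, tree); criticality squares it.  No expansion in the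
fluctuation, no property of any measure. [folklore] -/
theorem loopDefectBound_of_stepContraction {av : ∀ j, Averaging P j G} {dom : ∀ j, Set (GaugeField P j G)} {Cc θ : ℝ}
    (hcrit : ReTrCrit G Cc) (hCc : 0 ≤ Cc) (hdom : DomStable av dom) (hg : GaugeStable dom)
    (hstep : AvgStepContraction av dom θ) (hθ : 0 ≤ θ) (hflat : AvgFlat av) : LoopDefectBound av dom Cc θ := by
  intro k n hn x w hw V hV h1
  obtain ⟨Y, u, _, hEq, hTV⟩ := descend hdom hg hstep hθ n hn 1 V h1 hV
  rw [hEq, loopAt_gaugeAct_walk u Y x w hw, loopAt]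
  rw [iterFrom_one hflat n hn] at hTV
  have hdist : dist1 (holAt Y (walk x w)) ≤ (w.length : ℝ) * tv 1 V * θ ^ n := by
    rw [dist1_holAt_eq_bdist]
    refine (holAt_bdist_le_length_mul_tv 1 Y (walk x w)).trans ?_
    rw [length_walk]
    have hw0 : (0 : ℝ) ≤ (w.length : ℝ) := Nat.cast_nonneg _
    calc (w.length : ℝ) * tv 1 Y ≤ (w.length : ℝ) * (θ ^ n * tv 1 V) := mul_le_mul_of_nonneg_left hTV hw0
      _ = (w.length : ℝ) * tv 1 V * θ ^ n := by ring
  refine (hcrit (holAt Y (walk x w))).trans (mul_le_mul_of_nonneg_left ?_ hCc)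
  exact pow_le_pow_left₀ (GaugeGroup.dist1_nonneg _) hdist 2

/-- The defect bound with the SUPPORT made explicit: a configuration that is trivial off a finite set `Λ` of level-`k` bonds
whose one-bond deviations are at most `D` (the component's variables, in a small-field domain) has loop defect at most
`Cd·(|w|·|Λ|·D)²·(θ²)ⁿ` — the weight `(|w|·|Λ|·D)²` is polynomial in the component, the rate `θ²` per level is the
SECOND-ORDER currency of row NE1′ (`T4TubeBudget`: K-uniform iff `L⁴θ² ≤ 1`; `θ = L⁻³` gives `L⁻²`). [folklore] -/
theorem loopDefect_le_of_support {av : ∀ j, Averaging P j G} {dom : ∀ j, Set (GaugeField P j G)} {Cd θ : ℝ}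
    (h : LoopDefectBound av dom Cd θ) (hCd : 0 ≤ Cd) (hθ : 0 ≤ θ) {k n : ℕ} (hn : k + n ≤ P.m + P.K)
    (x : Site P (k + n)) (w : List (Letter P.d)) (hw : walkEnd x w = x) (V : GaugeField P k G) (hV : V ∈ dom k)
    (h1 : (1 : GaugeField P k G) ∈ dom k) (Λ : Finset (PBond P k)) (hoff : ∀ b, b ∉ Λ → V b = 1) {D : ℝ}
    (hD : ∀ b ∈ Λ, dist1 (V b) ≤ D) :
    1 - loopAt (iterFrom av k n V) (walk x w) ≤ Cd * ((w.length : ℝ) * Λ.card * D) ^ 2 * (θ ^ 2) ^ n := by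
  have htv : tv (1 : GaugeField P k G) V ≤ Λ.card * D := by
    rw [tv_eq_sum_of_agreeOff Λ 1 V fun b hb => (hoff b hb).symm]
    calc ∑ b ∈ Λ, bdist ((1 : GaugeField P k G) b) (V b) = ∑ b ∈ Λ, dist1 (V b) :=
          Finset.sum_congr rfl fun b _ => by rw [bdist_def, show (1 : GaugeField P k G) b = 1 from rfl, inv_one, one_mul]
      _ ≤ ∑ _b ∈ Λ, D := Finset.sum_le_sum fun b hb => hD b hb
      _ = Λ.card * D := by rw [Finset.sum_const, nsmul_eq_mul]
  refine (h k n hn x w hw V hV h1).trans ?_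
  have hw0 : (0 : ℝ) ≤ (w.length : ℝ) := Nat.cast_nonneg _
  have hpow : ((w.length : ℝ) * tv 1 V * θ ^ n) ^ 2 ≤ ((w.length : ℝ) * Λ.card * D) ^ 2 * (θ ^ 2) ^ n := by
    rw [← pow_mul, mul_comm 2 n, pow_mul, ← mul_pow]
    refine pow_le_pow_left₀ (mul_nonneg (mul_nonneg hw0 (tv_nonneg _ _)) (pow_nonneg hθ n)) ?_ 2
    calc (w.length : ℝ) * tv 1 V * θ ^ n ≤ (w.length : ℝ) * (Λ.card * D) * θ ^ n :=
          mul_le_mul_of_nonneg_right (mul_le_mul_of_nonneg_left htv hw0) (pow_nonneg hθ n)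
      _ = (w.length : ℝ) * Λ.card * D * θ ^ n := by ring
  calc Cd * ((w.length : ℝ) * tv 1 V * θ ^ n) ^ 2 ≤ Cd * (((w.length : ℝ) * Λ.card * D) ^ 2 * (θ ^ 2) ^ n) :=
        mul_le_mul_of_nonneg_left hpow hCd
    _ = Cd * ((w.length : ℝ) * Λ.card * D) ^ 2 * (θ ^ 2) ^ n := by ring

end Tower

/-! ## §4 The quotient constants: the `t`-discrepancy of a log-quotient of two rider-tilted laws is at most twice the defect -/

section Quotient

variable {Ω : Type*} [MeasurableSpace Ω]

/-- Integrability of a rider against a probability law when the exponent is essentially bounded. [folklore] -/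
theorem integrable_exp_mul_of_bound (ν : Measure Ω) [IsProbabilityMeasure ν] {Gd : Ω → ℝ}
    (hG : AEStronglyMeasurable Gd ν) {s : ℝ} (hb : ∀ᵐ x ∂ν, |Gd x| ≤ s) (t : ℝ) :
    Integrable (fun x => Real.exp (t * Gd x)) ν := by
  refine (integrable_const (Real.exp (|t| * s))).mono' ?_ ?_
  · exact Real.continuous_exp.comp_aestronglyMeasurable (hG.const_mul t)
  · filter_upwards [hb] with x hx
    rw [Real.norm_eq_abs, abs_of_pos (Real.exp_pos _)]
    refine Real.exp_le_exp.mpr ?_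
    calc t * Gd x ≤ |t * Gd x| := le_abs_self _
      _ = |t| * |Gd x| := abs_mul _ _
      _ ≤ |t| * s := mul_le_mul_of_nonneg_left hx (abs_nonneg t)

/-- THE RIDER INTEGRAL IS SANDWICHED: `e^{−|t|s} ≤ ∫ e^{t·G} dν ≤ e^{|t|s}` for a probability law `ν` and `|G| ≤ s` a.e.
[folklore] -/
theorem integral_exp_mul_mem_Icc (ν : Measure Ω) [IsProbabilityMeasure ν] {Gd : Ω → ℝ}
    (hG : AEStronglyMeasurable Gd ν) {s : ℝ} (hb : ∀ᵐ x ∂ν, |Gd x| ≤ s) (t : ℝ) :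
    Real.exp (-(|t| * s)) ≤ ∫ x, Real.exp (t * Gd x) ∂ν ∧ ∫ x, Real.exp (t * Gd x) ∂ν ≤ Real.exp (|t| * s) := by
  have hi := integrable_exp_mul_of_bound ν hG hb t
  have hts : ∀ᵐ x ∂ν, |t * Gd x| ≤ |t| * s := by
    filter_upwards [hb] with x hx
    rw [abs_mul]
    exact mul_le_mul_of_nonneg_left hx (abs_nonneg t)
  constructor
  · have h := integral_mono_ae (integrable_const (Real.exp (-(|t| * s)))) hi
      (show (fun _ => Real.exp (-(|t| * s))) ≤ᵐ[ν] fun x => Real.exp (t * Gd x) by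
        filter_upwards [hts] with x hx
        exact Real.exp_le_exp.mpr (by linarith [neg_abs_le (t * Gd x)]))
    simpa using h
  · have h := integral_mono_ae hi (integrable_const (Real.exp (|t| * s)))
      (show (fun x => Real.exp (t * Gd x)) ≤ᵐ[ν] fun _ => Real.exp (|t| * s) by
        filter_upwards [hts] with x hx
        exact Real.exp_le_exp.mpr (by linarith [le_abs_self (t * Gd x)]))
    simpa using h

/-- **THE LOG-QUOTIENT `t`-DISCREPANCY IS AT MOST TWICE THE DEFECT.**  For two probability laws `ν₁, ν₂` (the normalised
numerator and denominator fibre laws of ONE large-field quotient at the trivial exterior field — [Balaban1989LargeFieldI] p. 176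
(0.3), p. 201 (1.100): which laws is NODE O's business, nothing about them is assumed beyond `|G| ≤ s` a.e.) and a rider exponent
`G` (the loop variable of the averaged configuration minus its flat value, `G = W̃ − 1`, so `s = sup(1 − W̃)` is §3's defect):
`|log ∫e^{tG}dν₁ − log ∫e^{tG}dν₂| ≤ 2·|t|·s`.  NO symmetry, conditional mean, or covariance structure of the laws enters —
this is why the first-order channel of NE7.md §4ter is absent at `U = 1`. [folklore] -/
theorem abs_log_integral_exp_sub_le (ν₁ ν₂ : Measure Ω) [IsProbabilityMeasure ν₁] [IsProbabilityMeasure ν₂]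
    {Gd : Ω → ℝ} (hG₁ : AEStronglyMeasurable Gd ν₁) (hG₂ : AEStronglyMeasurable Gd ν₂) {s : ℝ}
    (hb₁ : ∀ᵐ x ∂ν₁, |Gd x| ≤ s) (hb₂ : ∀ᵐ x ∂ν₂, |Gd x| ≤ s) (t : ℝ) :
    |Real.log (∫ x, Real.exp (t * Gd x) ∂ν₁) - Real.log (∫ x, Real.exp (t * Gd x) ∂ν₂)| ≤ 2 * (|t| * s) := by
  have key : ∀ (ν : Measure Ω) [IsProbabilityMeasure ν], AEStronglyMeasurable Gd ν → (∀ᵐ x ∂ν, |Gd x| ≤ s) →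
      -(|t| * s) ≤ Real.log (∫ x, Real.exp (t * Gd x) ∂ν) ∧ Real.log (∫ x, Real.exp (t * Gd x) ∂ν) ≤ |t| * s := by
    intro ν _ hG hb
    obtain ⟨hlo, hhi⟩ := integral_exp_mul_mem_Icc ν hG hb t
    have hpos : 0 < ∫ x, Real.exp (t * Gd x) ∂ν := (Real.exp_pos _).trans_le hlo
    exact ⟨(Real.le_log_iff_exp_le hpos).mpr hlo, (Real.log_le_iff_le_exp hpos).mpr hhi⟩
  obtain ⟨h1lo, h1hi⟩ := key ν₁ hG₁ hb₁
  obtain ⟨h2lo, h2hi⟩ := key ν₂ hG₂ hb₂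
  rw [abs_le]
  constructor <;> linarith

end Quotient

/-! ## §5 Assembly: the per-component shape `QLaPt` in the SECOND-order currency `b = θ²`, by name -/

section Assembly

variable {D : Type*}

/-- **(QL-a) PER COMPONENT FROM THE DEFECT** (bookkeeping): if the constant of each component `X` of the ledger is the logarithm
of a quotient of two rider-tilted laws whose exponent defect is at most `Cd·wt X·(θ^{K − sc X})²` (§3–§4: `wt X` the squared
total-variation range `(|w|·|Λ_X|·D)²` of the component, `θ` the one-step contraction rate), then for `|t| ≤ l₀` the
`t`-discrepancies satisfy `Spine.NE7.QLaPt wf sc wt ct c0 K (2·l₀·Cd) (θ²)` — the SECOND-order currency; with `θ = L⁻³` and the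
census `Λ = L⁴`, `Spine.NE7.qla_secondOrder` (p340302) turns it into `QLa` with `a = L⁻² < 1`.  The first-order currency
`b = θ` (NE7.md §4bis: `a = L > 1`, (QL-a) fails as a letter) never arises at `U = 1`. [folklore] -/
theorem qlaPt_of_defect {wf : Finset D} {sc : D → ℕ} {wt ct c0 : D → ℝ} {K : ℕ} {l₀ Cd θ t : ℝ} (ht : |t| ≤ l₀)
    (hCd : 0 ≤ Cd) (hwt : ∀ X ∈ wf, 0 ≤ wt X)
    (hdef : ∀ X ∈ wf, |ct X - c0 X| ≤ 2 * (|t| * (Cd * wt X * (θ ^ (K - sc X)) ^ 2))) :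
    QLaPt wf sc wt ct c0 K (2 * l₀ * Cd) (θ ^ 2) := by
  intro X hX
  refine (hdef X hX).trans ?_
  rw [← pow_mul, mul_comm (K - sc X) 2, pow_mul]
  have hs : 0 ≤ Cd * wt X * (θ ^ 2) ^ (K - sc X) :=
    mul_nonneg (mul_nonneg hCd (hwt X hX)) (pow_nonneg (sq_nonneg θ) _)
  calc 2 * (|t| * (Cd * wt X * (θ ^ 2) ^ (K - sc X))) ≤ 2 * (l₀ * (Cd * wt X * (θ ^ 2) ^ (K - sc X))) :=
        mul_le_mul_of_nonneg_left (mul_le_mul_of_nonneg_right ht hs) zero_le_two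
    _ = 2 * l₀ * Cd * wt X * (θ ^ 2) ^ (K - sc X) := by ring

open Literature.MathematicalPhysics.QuantumFieldTheory.Balaban1983to89.T4RecentScale (Multiplicity) in
/-- … and with the (0.26)-type component census (`T4RecentScale.Multiplicity`, weight `wt`, volume factor `Λ`): `Spine.NE7.QLa`
with `Ew = 2·l₀·Cd·Cw` and `a = θ²·Λ` (`qla_of_pt_multiplicity`, p340302).  In d = 4 with `θ = θ₁ = L⁻³`, `Λ = L⁴`:
`a = L⁻²` (`rate_secondOrder_eq`). [folklore] -/
theorem qla_of_defect {wf : Finset D} {sc : D → ℕ} {wt ct c0 : D → ℝ} {K : ℕ} {l₀ Cd θ t Cw vol Λ : ℝ} (ht : |t| ≤ l₀)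
    (hCd : 0 ≤ Cd) (hwt : ∀ X ∈ wf, 0 ≤ wt X)
    (hdef : ∀ X ∈ wf, |ct X - c0 X| ≤ 2 * (|t| * (Cd * wt X * (θ ^ (K - sc X)) ^ 2)))
    (hM : Multiplicity wf sc wt Cw vol Λ K) :
    QLa wf sc ct c0 K vol (2 * l₀ * Cd * Cw) (θ ^ 2 * Λ) :=
  qla_of_pt_multiplicity (qlaPt_of_defect ht hCd hwt hdef) hM
    (mul_nonneg (mul_nonneg zero_le_two ((abs_nonneg t).trans ht)) hCd) (sq_nonneg θ)

end Assembly

end Summit.QuantumFields.BalabanUV.T4Continuum.Spine.NE7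

end
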